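import Summits.AtomisticToContinuum.Crystallization.Theorems.LoopTunnelDialCohesionDial

/-!
# LoopTunnelDial — the COHESION DIAL beneath TENUOUS, part 2: CONCORDANCE with route `CohesionFrustrationStrain` (lens-5 generation 21; crux `PocketCase`, stmt-AtomisticToContinuum-27294)

Landing-kit file 9, second half (§5 of the lens-5 g21 file `LoopTunnelDialCohesionDial.lean`, split for the 400-line landing lint;
§1–§4 — exposure at a hole scale, the packing lemma, the cohesion statements, monotonicity — are the tree module
`LoopTunnelDialCohesionDial`).  All `[folklore]`; 0 sorry.
-/


noncomputable section

open scoped BigOperators Classical Topology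
open Filter MeasureTheory
open Literature.MathematicalPhysics.StatisticalMechanics
open Summit.AtomisticToContinuum.Crystallization.Theorems.GrainPercolationDialCrossCeiling (E3 ballChunk ballChunk_card_le)
open Summit.AtomisticToContinuum.Crystallization.Theorems.LjLaminarWindowsSketch (lennardJones_groundState_dist_ge_seven_tenths)
open Summit.AtomisticToContinuum.Crystallization.Theorems.ChargedEnergyGapNegative (eStar crysEnergyLimit)
open Summit.AtomisticToContinuum.Crystallization.Theorems.LoopTunnelDialSieveCurrency
open Summit.AtomisticToContinuum.Crystallization.Theorems.LoopTunnelDialThinAnatomy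

namespace Summit.AtomisticToContinuum.Crystallization.Theorems.LoopTunnelDialCohesionDial

variable {N : ℕ}

/-! ## §5 CONCORDANCE BY NAME with route `CohesionFrustrationStrain` (lens-6): its crux `Cohesion` (stmt-AtomisticToContinuum-24040) empties TENUOUS

`Cohesion` is a SEQUENTIAL, qualitative no-foam law at the FIXED hole scale `9/10` with reach `1`: along every sequence of ground states the
fraction of VACUUM-ADJACENT particles (an empty open `9/10`-ball centred within distance `1`) tends to `0`.  Since `9/10 < 32/33`, the packing
lemma + a ROLLING-BALL step (shrink the empty `r₀`-ball found near a sparse particle towards its nearest particle `k`: `k` is vacuum-adjacent and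
within `2(s − r₀)` of the sparse particle) + the landed `7/10`-separation and ball-count (`ballChunk_card_le`) give: in a `7/10`-separated `s`-sparse
configuration at least `N / (512 (s − r₀)³)` particles are vacuum-adjacent (`card_vacuumAdjacent_ge`).  A diagonal ground-state sequence through the
sparse ground states (the other terms supplied by the PROVED Literature fact `LennardJonesGroundStatesExist_holds`) then contradicts `Cohesion`:
`CohesionLaw → NoSparseGS s` for every `s` admitting a hole scale `r₀ ∈ (9/10, 1]` with `s·r₀ ≤ s − r₀` (i.e. `s > 9`), in particular
`CohesionLaw → NoSparseGS 32` (`noSparseGS32_of_cohesionLaw`).  `CohesionLaw` is VERBATIM the body of `CohesionFrustrationStrain.Cohesion`; the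
route-level file `LoopTunnelDialCohesionConcordance.lean` restates the implication with the item BY NAME.  Conversely-directed link:
`ExposedSitesCostAt (9/10) → CohesionLaw` (`cohesionLaw_of_costAt`). -/

/-- **`VacuumAdjacent y i`** — VERBATIM the exposure predicate of `CohesionFrustrationStrain.Cohesion` (stmt-AtomisticToContinuum-24040): a point within
distance `1` of `y i` whose OPEN `9/10`-ball holds no particle. [line vocabulary · LoopTunnelDial cohesion dial · crux stmt-AtomisticToContinuum-27294 · definition, not a cited fact] -/
def VacuumAdjacent {N : ℕ} (y : Fin N → E3) (i : Fin N) : Prop :=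
  ∃ p : E3, dist p (y i) ≤ 1 ∧ ∀ j : Fin N, 9 / 10 < dist p (y j)

/-- **`CohesionLaw`** — VERBATIM the body of route `CohesionFrustrationStrain`'s crux `Cohesion` (stmt-AtomisticToContinuum-24040, rank 3, «difficulty L»):
along every sequence of Lennard-Jones ground states the vacuum-adjacent fraction tends to `0`. [SUFFICIENT for `NoSparseGS 32`, hence for TENUOUS
(`noSparseGS32_of_cohesionLaw`); an EXISTING typed crux of another decomposition cell — the residual core of `PocketCase` is CONCORDANT with it] [line vocabulary · LoopTunnelDial cohesion dial · crux stmt-AtomisticToContinuum-27294 · definition, not a cited fact] -/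
def CohesionLaw : Prop :=
  ∀ x : (N : ℕ) → (Fin N → EuclideanSpace ℝ (Fin 3)), (∀ N, IsGroundState lennardJones (x N)) →
    Filter.Tendsto (fun N : ℕ => (Nat.card {i : Fin N // ∃ y : EuclideanSpace ℝ (Fin 3), dist y (x N i) ≤ 1 ∧
      ∀ j : Fin N, 9 / 10 < dist y (x N j)} : ℝ) / N) Filter.atTop (nhds 0)

/-- A vacuum-adjacent particle is `(9/10, 1)`-exposed (open empty ball ⟹ closed hole at the same scale). [folklore] -/
theorem exposed_of_vacuumAdjacent {y : Fin N → E3} {i : Fin N} (h : VacuumAdjacent y i) : Exposed (9 / 10) 1 y i := by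
  obtain ⟨p, hp, hfar⟩ := h
  exact ⟨p, hp, fun j => (hfar j).le⟩

/-- **ROLLING BALL (PROVED).**  If particle `i` is `(r₀, R)`-exposed with `9/10 < r₀ ≤ 1`, then the particle `k` nearest to the empty ball's centre is
VACUUM-ADJACENT (shrink the ball towards `y k` until it touches at distance `r₀`) and lies within `2R` of `y i`. -/
theorem vacuumAdjacent_near_of_exposed {r₀ R : ℝ} (hr9 : 9 / 10 < r₀) (hr1 : r₀ ≤ 1) {y : Fin N → E3} {i : Fin N}
    (hi : Exposed r₀ R y i) : ∃ k : Fin N, VacuumAdjacent y k ∧ dist (y k) (y i) ≤ 2 * R := by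
  obtain ⟨p, hp, hfar⟩ := hi
  obtain ⟨k, -, hk⟩ := Finset.exists_min_image Finset.univ (fun j => dist p (y j)) ⟨i, Finset.mem_univ i⟩
  set d := dist p (y k) with hd
  have hdk : r₀ ≤ d := hfar k
  have hd0 : 0 < d := lt_of_lt_of_le (by linarith) hdk
  have hdR : d ≤ R := (hk i (Finset.mem_univ i)).trans hp
  have hc0 : 0 ≤ r₀ / d := div_nonneg (by linarith) hd0.le
  have hc1 : r₀ / d ≤ 1 := (div_le_one hd0).2 hdk
  refine ⟨k, ⟨y k + (r₀ / d) • (p - y k), ?_, ?_⟩, ?_⟩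
  · have h1 : dist (y k + (r₀ / d) • (p - y k)) (y k) = r₀ := by
      rw [dist_eq_norm, add_sub_cancel_left, norm_smul, Real.norm_eq_abs, abs_of_nonneg hc0, ← dist_eq_norm,
        div_mul_cancel₀ _ hd0.ne']
    rw [h1]
    exact hr1
  · intro j
    have hpp' : dist p (y k + (r₀ / d) • (p - y k)) = d - r₀ := by
      have hv : p - (y k + (r₀ / d) • (p - y k)) = (1 - r₀ / d) • (p - y k) := by
        rw [sub_smul, one_smul]
        abel
      rw [dist_eq_norm, hv, norm_smul, Real.norm_eq_abs, abs_of_nonneg (by linarith), ← dist_eq_norm, sub_mul, one_mul,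
        div_mul_cancel₀ _ hd0.ne']
    have hj : d ≤ dist p (y j) := hk j (Finset.mem_univ j)
    have htri := dist_triangle p (y k + (r₀ / d) • (p - y k)) (y j)
    linarith
  · calc dist (y k) (y i) ≤ dist (y k) p + dist p (y i) := dist_triangle _ _ _
      _ = d + dist p (y i) := by rw [dist_comm (y k) p]
      _ ≤ 2 * R := by linarith

/-- **COUNTING (PROVED).**  In a `7/10`-separated `s`-sparse configuration (hole scale `r₀ ∈ (9/10, 1]`, `s·r₀ ≤ s − r₀`, `1 ≤ 2(s − r₀)`) the
vacuum-adjacent particles are at least `N / (64·(2(s − r₀))³)` in number: every particle has one within `2(s − r₀)`, and a `2(s − r₀)`-ball holds at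
most `64·(2(s − r₀))³` particles (`ballChunk_card_le`). -/
theorem card_vacuumAdjacent_ge {s r₀ : ℝ} (hr9 : 9 / 10 < r₀) (hr1 : r₀ ≤ 1) (hR : s * r₀ ≤ s - r₀) (hs1 : 1 ≤ 2 * (s - r₀))
    {y : Fin N → E3} (hsep : ∀ a b : Fin N, a ≠ b → (7 : ℝ) / 10 ≤ dist (y a) (y b)) (hsp : Sparse s y) :
    (N : ℝ) ≤ (Nat.card {i : Fin N // VacuumAdjacent y i} : ℝ) * (64 * (2 * (s - r₀)) ^ 3) := by
  classical
  have hr0 : 0 < r₀ := by linarith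
  set V : Finset (Fin N) := Finset.univ.filter (fun k : Fin N => VacuumAdjacent y k) with hV
  have hcover : (Finset.univ : Finset (Fin N)) ⊆ V.biUnion (fun k => ballChunk y k (2 * (s - r₀))) := by
    intro i _
    obtain ⟨k, hk, hki⟩ := vacuumAdjacent_near_of_exposed hr9 hr1 (exposed_of_sparse hr0 hR hsp i)
    rw [Finset.mem_biUnion]
    refine ⟨k, Finset.mem_filter.2 ⟨Finset.mem_univ _, hk⟩, mem_ballChunk.2 ?_⟩
    rwa [dist_comm] at hki
  have h1 : N ≤ ∑ k ∈ V, (ballChunk y k (2 * (s - r₀))).card :=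
    calc N = (Finset.univ : Finset (Fin N)).card := (Finset.card_fin N).symm
      _ ≤ (V.biUnion (fun k => ballChunk y k (2 * (s - r₀)))).card := Finset.card_le_card hcover
      _ ≤ ∑ k ∈ V, (ballChunk y k (2 * (s - r₀))).card := Finset.card_biUnion_le
  have h2 : ∀ k ∈ V, ((ballChunk y k (2 * (s - r₀))).card : ℝ) ≤ 64 * (2 * (s - r₀)) ^ 3 :=
    fun k _ => ballChunk_card_le hsep k hs1
  have h3 : (N : ℝ) ≤ ∑ k ∈ V, ((ballChunk y k (2 * (s - r₀))).card : ℝ) := by exact_mod_cast h1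
  have h4 : ∑ k ∈ V, ((ballChunk y k (2 * (s - r₀))).card : ℝ) ≤ V.card • (64 * (2 * (s - r₀)) ^ 3) :=
    Finset.sum_le_card_nsmul V _ _ h2
  rw [nsmul_eq_mul] at h4
  have hVcard : (Nat.card {i : Fin N // VacuumAdjacent y i} : ℝ) = V.card := by
    rw [hV, Nat.card_eq_fintype_card, Fintype.card_subtype]
  rw [hVcard]
  linarith

/-- **`CohesionLaw → NoSparseGS s` (PROVED) for every `s` with a hole scale `r₀ ∈ (9/10, 1]`, `s·r₀ ≤ s − r₀`, `1 ≤ 2(s − r₀)`.**  Diagonal argument: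
were `s`-sparse ground states to persist, the ground-state sequence through them (PROVED existence elsewhere, `LennardJonesGroundStatesExist_holds`)
would have vacuum-adjacent fraction `≥ 1/(64·(2(s − r₀))³)` infinitely often (`card_vacuumAdjacent_ge` with the landed `7/10`-separation). -/
theorem noSparseGS_of_cohesionLaw {s r₀ : ℝ} (hr9 : 9 / 10 < r₀) (hr1 : r₀ ≤ 1) (hR : s * r₀ ≤ s - r₀) (hs1 : 1 ≤ 2 * (s - r₀))
    (h : CohesionLaw) : NoSparseGS s := by
  classical
  by_contra hns
  unfold NoSparseGS at hns
  push Not at hns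
  -- hns : ∀ N₁, ∃ N, N₁ ≤ N ∧ ∃ y, IsGroundState lennardJones y ∧ Sparse s y
  let B : ℕ → Prop := fun N => ∃ y : Fin N → E3, IsGroundState lennardJones y ∧ Sparse s y
  let x : (N : ℕ) → (Fin N → E3) := fun N =>
    if hB : B N then Classical.choose hB else Classical.choose (LennardJonesGroundStatesExist_holds N)
  have hxGS : ∀ N, IsGroundState lennardJones (x N) := by
    intro N
    by_cases hB : B N
    · simp only [x, dif_pos hB]
      exact (Classical.choose_spec hB).1
    · simp only [x, dif_neg hB]
      exact Classical.choose_spec (LennardJonesGroundStatesExist_holds N)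
  have hxB : ∀ N, B N → Sparse s (x N) := by
    intro N hB
    simp only [x, dif_pos hB]
    exact (Classical.choose_spec hB).2
  have hlim := h x hxGS
  set C : ℝ := 64 * (2 * (s - r₀)) ^ 3 with hC
  have hCpos : 0 < C := mul_pos (by norm_num) (pow_pos (by linarith) 3)
  obtain ⟨N₁, hN₁⟩ := eventually_atTop.1 (hlim.eventually (Iio_mem_nhds (show (0 : ℝ) < 1 / C by positivity)))
  obtain ⟨N, hN, hBN⟩ := hns (max N₁ 1)
  have hN1 : N₁ ≤ N := (le_max_left _ _).trans hN
  have hNpos : (0 : ℝ) < N := by exact_mod_cast (le_max_right N₁ 1).trans hN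
  have hfrac : (Nat.card {i : Fin N // VacuumAdjacent (x N) i} : ℝ) / N < 1 / C := hN₁ N hN1
  have hsep : ∀ a b : Fin N, a ≠ b → (7 : ℝ) / 10 ≤ dist (x N a) (x N b) :=
    fun a b hab => lennardJones_groundState_dist_ge_seven_tenths (hxGS N) hab
  have hcount := card_vacuumAdjacent_ge hr9 hr1 hR hs1 hsep (hxB N hBN)
  rw [div_lt_div_iff₀ hNpos hCpos] at hfrac
  linarith

/-- **At the frozen numeral:** `CohesionLaw → NoSparseGS 32` (hole scale `32/33 ∈ (9/10, 1]`). -/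
theorem noSparseGS32_of_cohesionLaw (h : CohesionLaw) : NoSparseGS 32 :=
  noSparseGS_of_cohesionLaw (s := 32) (r₀ := 32 / 33) (by norm_num) (by norm_num) (by norm_num) (by norm_num) h

/-- … hence TENUOUS at `32` from lens-6's `Cohesion`. -/
theorem tenuousCertified32_of_cohesionLaw (h : CohesionLaw) : TenuousCertified 32 :=
  tenuousCertified_of_noSparseGS (noSparseGS32_of_cohesionLaw h)

/-- **The quantitative currency at hole scale `9/10` implies lens-6's qualitative law** (PROVED: a vacuum-adjacent particle is `(9/10, 1)`-exposed). -/
theorem cohesionLaw_of_costAt (h : ExposedSitesCostAt (9 / 10)) : CohesionLaw := by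
  intro x hx
  have hF := fractionSmall_of_costAt (R := 1) one_pos h
  refine Metric.tendsto_atTop.2 fun ε hε => ?_
  obtain ⟨N₁, hN₁⟩ := hF (ε / 2) (by linarith)
  refine ⟨max N₁ 1, fun N hN => ?_⟩
  have hN1 : N₁ ≤ N := (le_max_left _ _).trans hN
  have hNpos : (0 : ℝ) < N := by exact_mod_cast (le_max_right N₁ 1).trans hN
  have hle : (Nat.card {i : Fin N // VacuumAdjacent (x N) i} : ℝ) ≤ Nat.card {i : Fin N // Exposed (9 / 10) 1 (x N) i} := by
    exact_mod_cast Nat.card_le_card_of_injective _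
      (Subtype.impEmbedding _ _ (fun i hi => exposed_of_vacuumAdjacent hi)).injective
  have hb := hN₁ N hN1 (x N) (hx N)
  rw [Real.dist_eq, sub_zero]
  change |(Nat.card {i : Fin N // VacuumAdjacent (x N) i} : ℝ) / N| < ε
  rw [abs_of_nonneg (by positivity), div_lt_iff₀ hNpos]
  have hεN : 0 < ε * N := mul_pos hε hNpos
  linarith

end Summit.AtomisticToContinuum.Crystallization.Theorems.LoopTunnelDialCohesionDial
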